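import Literature.NumberTheory.Connes2026.LetterSemilocal
import Literature.NumberTheory.ConnesConsani2021.ArchimedeanPositivityOfEnclosures
import HarnessLib

/-!
# Connes 2026 (Letter) §7 — PROOF LAYER of `LetterSemilocal.lean`: Theorem 7.1 is a theorem

LABEL (line 1): RH-FREE literature (theorems only: no definition, no named fact).  bears_on: LADDER-RH
W-C/W-P (C1), cell `rh-crit`, sub-cell cc, overflow row O1 — record only.  WHAT THIS IS NOT: any claim about
RH — archimedean Weil positivity for the Sonin trace on the support `[2^{-1/2}, 2^{1/2}]` is an inequality
about the archimedean place alone (it is not RH-detecting); the RH-EQUIVALENT residual of the Connes–Consani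
corpus (`IsolatedCC`) is untouched; nothing here bears on the truth of RH.

Source: A. Connes, *The Riemann Hypothesis: past, present and a letter through time*, arXiv:2602.04022 (2026)
[bib `Connes2026Letter`], §7.2 Theorem 7.1 (held text `paper:arxiv-2602.04022`, p0024:L37), citing
[weilpos] = A. Connes, C. Consani, *Weil positivity and trace formula, the archimedean place*, Selecta Math.
(N.S.) 27 (2021) 77 [bib `ConnesConsani2021`], Theorem 1 (Intro p. 4).

## What is here

* `letter_thm_7_1` — **Letter, Theorem 7.1, unconditionally**: for every test function `g` with
  `tsupport g ⊆ [−(log 2)/2, (log 2)/2]` (additive avatar of "support in `[2^{-1/2}, 2^{1/2}]`") and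
  `ĝ(i/2) = ĝ(0) = 0`, and every finite orthonormal family `(ξ_i)` in Sonin's space `soninSpace 1 1`,
  `Σ_i Re⟨ξ_i | ϑ(g ∗ g*) ξ_i⟩ ≤ Re W_∞(g ∗ g*)` — i.e. "`W_∞(g ∗ g*) ≥ Tr(ϑ(g) 𝔖 ϑ(g)*)`" in the tree's
  finite-orthonormal-family typing of the Sonin trace.  The statement layer recorded Theorem 7.1 as the ALIAS
  `letter_thm_7_1_iff : (…) ↔ ConnesConsani2021.WeilArchPositivity_soninTrace` (`Iff.rfl`); the right-hand
  side is now the tree THEOREM `ConnesConsani2021.WeilArchPositivity_soninTrace_holds`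
  (`ArchimedeanPositivityOfEnclosures.lean`: CC 2021 Thm 4.7 + Prop 5.5/Lemma 6.3 + the kernel-checked
  Tier-2 window certificate of §6), so the Letter's theorem follows by `Iff.mpr`.  Kept in this separate
  proof-layer module so that the statement file `LetterSemilocal.lean` keeps its light imports.
-/

noncomputable section

open _root_.MeasureTheory Complex Set
open scoped Real

namespace Literature.NumberTheory.Connes2026

open Literature.NumberTheory.LFunctions Literature.NumberTheory.ConnesConsani2021

/-- **Letter, Theorem 7.1** (§7.2), UNCONDITIONALLY: "Let `g ∈ C_c^∞(ℝ_+^*)` have support in the interval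
`[2^{-1/2}, 2^{1/2}]` and Fourier transform vanishing at `i/2` and `0`. Then
`W_∞(g * g^*) ≥ Tr(ϑ(g) 𝔖 ϑ(g)^*)`", `𝔖` the orthogonal projection onto Sonin's space — in the tree's typing
(additive avatar `tsupport g ⊆ [−(log 2)/2, (log 2)/2]`, `mulFourier g (I/2) = 0`, `mulFourier g 0 = 0`, Sonin
trace as the supremum over finite orthonormal families of `soninSpace 1 1`).  PROVED: the alias
`letter_thm_7_1_iff` composed with the tree theorem `WeilArchPositivity_soninTrace_holds` (= Connes–Consani
2021, Theorem 1).  RH-FREE: an inequality at the archimedean place, not RH-detecting.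
[cite: Connes2026Letter, Thm 7.1 §7.2 (arXiv p0024:L37); ConnesConsani2021, Thm. 1 (Intro p. 4)] -/
theorem letter_thm_7_1 :
    ∀ g : ℝ → ℂ, IsWeilTest g →
      tsupport g ⊆ Icc (-(Real.log 2 / 2)) (Real.log 2 / 2) →
      mulFourier g (I / 2) = 0 → mulFourier g 0 = 0 →
      ∀ (n : ℕ) (ξ : Fin n → Lp ℂ 2 (volume : Measure ℝ)),
        Orthonormal ℂ ξ → (∀ i, ξ i ∈ soninSpace 1 1) →
          ∑ i, (soninTraceForm (weilConv g (weilReflect g)) (ξ i : ℝ → ℂ)).re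
            ≤ (archW (weilConv g (weilReflect g))).re :=
  letter_thm_7_1_iff.mpr WeilArchPositivity_soninTrace_holds

end Literature.NumberTheory.Connes2026
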